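import Mathlib
import Literature.Computability.Complexity.GraphEncodings
import Literature.Computability.Complexity.GraphCanonization
import Summits.PneNP.PneNP.Theorems.SymmetryBudgetWindowBarrierGraphBridge

/-!
# Twin-isomorphism bridge for stub `stub_twinIsoInP_of_canonicalForm` (line `bijection-gauge-twin-iso`,
crux `SymmetryBudget.WindowBarrier`, item stmt-PneNP-2145)

The graph side of the reduction "twin isomorphism ⟶ colour-isomorphism of ONE coloured graph". For an
`m`-vertex graph `G` with `g = ⌊log₂ m⌋` free vertices `fre j = n + j` (`n = m - g`,
`SymmetryBudgetWindowBarrierGraphBridge.lean`), a vertex is MARKED (`marked G`) when it is adjacent to the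
ordered vertex `0`; the statement's halves are `A = {u | m ≤ u + g ∧ u ∈ marked G}` and
`B = {u | m ≤ u + g ∧ u ∉ marked G}`
(`m ≤ u + g ↔ u` is free).

* `twinG G` — the TWIN GRAPH on `Fin g`: the free graph `G.comap fre` with every edge between the two
  marker classes deleted;
* `chi b G` — the colouring `j ↦ [[fre j ∈ marked G] = b]` (`chi true` is `1` on the marked, `chi false` on the
  unmarked free vertices);
* `halfEquiv P : {j // P (fre j)} ≃ {u | m ≤ u + ⌊log₂ m⌋ ∧ P u}` — the halves as marker classes;
* **`twinIso_iff`**: `G[A] ≃g G[B]` exists iff `twinG G` has a colour-SWAPPING automorphism, i.e. iff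
  `ColIso g (twinG G) (chi true G) (twinG G) (chi false G)` — (⇒) glue `φ : G[A] ≃g G[B]` on the marked
  class with `φ⁻¹` on the unmarked class (an involution of `Fin g`, `swapIso`); (⇐) restrict a swapping
  automorphism to the marked class (`isoOfSwap`); inside a class `twinG G` is the free graph and across
  the classes it has no edges.
-/

-- `Summit.PneNP.PneNP.…` duplicates `PneNP` BY DESIGN (single-problem summit).
set_option linter.dupNamespace false

namespace Summit.PneNP.PneNP.Theorems.TwinIso

open Literature.Computability.Complexity CompleteInvariant
open scoped Classical

variable {m : ℕ}

/-! ### Marked vertices, the twin graph, the two colourings -/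

/-- **The marked vertices**: the neighbours of the ordered vertex `0` (empty for `m = 0`). -/
def marked (G : SimpleGraph (Fin m)) : Set (Fin m) := {u | ∃ h : 0 < m, G.Adj ⟨0, h⟩ u}

/-- Membership in `marked`. -/
theorem mem_marked_iff (G : SimpleGraph (Fin m)) (u : Fin m) : u ∈ marked G ↔ ∃ h : 0 < m, G.Adj ⟨0, h⟩ u := Iff.rfl

/-- **The twin graph** on the `g` free vertices: the free graph with the edges between the two marker
classes deleted. -/
def twinG (G : SimpleGraph (Fin m)) : SimpleGraph (Fin (gg m)) where
  Adj j j' := G.Adj (fre m j) (fre m j') ∧ (fre m j ∈ marked G ↔ fre m j' ∈ marked G)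
  symm := ⟨fun _ _ h => ⟨h.1.symm, h.2.symm⟩⟩
  loopless := ⟨fun _ h => h.1.ne rfl⟩

/-- Adjacency in the twin graph. -/
theorem twinG_adj (G : SimpleGraph (Fin m)) (j j' : Fin (gg m)) :
    (twinG G).Adj j j' ↔ G.Adj (fre m j) (fre m j') ∧ (fre m j ∈ marked G ↔ fre m j' ∈ marked G) := Iff.rfl

/-- **The marker colourings**: `chi b G j = 1` if `[fre j ∈ marked G] = b`, else `0`. -/
noncomputable def chi (b : Bool) (G : SimpleGraph (Fin m)) (j : Fin (gg m)) : ℕ :=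
  if decide (fre m j ∈ marked G) = b then 1 else 0

/-- Inside a marker class the twin graph is the free graph. -/
theorem twinG_adj_iff {G : SimpleGraph (Fin m)} {j j' : Fin (gg m)} (h : fre m j ∈ marked G ↔ fre m j' ∈ marked G) :
    (twinG G).Adj j j' ↔ G.Adj (fre m j) (fre m j') :=
  (twinG_adj G j j').trans ⟨fun a => a.1, fun a => ⟨a, h⟩⟩

/-- Across the marker classes the twin graph has no edges. -/
theorem not_twinG_adj {G : SimpleGraph (Fin m)} {j j' : Fin (gg m)} (h : ¬ (fre m j ∈ marked G ↔ fre m j' ∈ marked G)) :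
    ¬ (twinG G).Adj j j' :=
  fun a => h ((twinG_adj G j j').1 a).2

/-- The colour-swap condition in marker language. -/
theorem chi_swap_iff (G : SimpleGraph (Fin m)) (j j' : Fin (gg m)) :
    chi false G j' = chi true G j ↔ (fre m j' ∈ marked G ↔ fre m j ∉ marked G) := by
  unfold chi
  by_cases h : fre m j ∈ marked G <;> by_cases h' : fre m j' ∈ marked G <;> simp [h, h']

/-! ### The halves as marker classes -/

/-- `m ≤ u + ⌊log₂ m⌋` says that `u` is free. -/
theorem nn_le_iff (u : Fin m) : nn m ≤ (u : ℕ) ↔ m ≤ (u : ℕ) + Nat.log 2 m := by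
  show m - Nat.log 2 m ≤ (u : ℕ) ↔ _; omega

/-- The index of a free vertex. -/
theorem sub_nn_lt {u : Fin m} (h : m ≤ (u : ℕ) + Nat.log 2 m) : (u : ℕ) - nn m < gg m := by
  have := u.2
  show (u : ℕ) - (m - Nat.log 2 m) < Nat.log 2 m
  omega

/-- A free vertex is `fre` of its index. -/
theorem fre_sub_nn {u : Fin m} (h : m ≤ (u : ℕ) + Nat.log 2 m) : fre m ⟨(u : ℕ) - nn m, sub_nn_lt h⟩ = u :=
  Fin.ext (by have := (nn_le_iff u).2 h; simp; omega)

/-- **The marker class `{j // P (fre j)}` is the statement's half `{u | m ≤ u + ⌊log₂ m⌋ ∧ P u}`.** -/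
def halfEquiv (P : Fin m → Prop) :
    {j : Fin (gg m) // P (fre m j)} ≃ ({u : Fin m | m ≤ (u : ℕ) + Nat.log 2 m ∧ P u} : Set (Fin m)) where
  toFun j := ⟨fre m j.1, (nn_le_iff _).1 (Nat.le_add_right _ _), j.2⟩
  invFun u := ⟨⟨(u.1 : ℕ) - nn m, sub_nn_lt u.2.1⟩, by rw [fre_sub_nn u.2.1]; exact u.2.2⟩
  left_inv j := by ext; simp
  right_inv u := by
    ext
    have := (nn_le_iff u.1).2 u.2.1
    simp only [fre_val]
    omega

/-- Value of `halfEquiv`. -/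
@[simp] theorem halfEquiv_apply_coe (P : Fin m → Prop) (j : {j : Fin (gg m) // P (fre m j)}) :
    ((halfEquiv P j : {u : Fin m | m ≤ (u : ℕ) + Nat.log 2 m ∧ P u}) : Fin m) = fre m j.1 := rfl

/-- Value of `halfEquiv⁻¹`. -/
@[simp] theorem fre_halfEquiv_symm (P : Fin m → Prop) (u : ({u : Fin m | m ≤ (u : ℕ) + Nat.log 2 m ∧ P u} : Set (Fin m))) :
    fre m ((halfEquiv P).symm u).1 = u.1 :=
  fre_sub_nn u.2.1

/-! ### (⇐) From a colour-swapping automorphism to an isomorphism of the halves -/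

section swap

variable {G : SimpleGraph (Fin m)}

/-- Restricting a swapping automorphism `σ` of the twin graph to the marked class. -/
def isoOfSwap (σ : twinG G ≃g twinG G) (hσ : ∀ j, fre m (σ j) ∈ marked G ↔ fre m j ∉ marked G) :
    SimpleGraph.induce {u : Fin m | m ≤ (u : ℕ) + Nat.log 2 m ∧ u ∈ marked G} G ≃g
      SimpleGraph.induce {u : Fin m | m ≤ (u : ℕ) + Nat.log 2 m ∧ u ∉ marked G} G where
  toEquiv := (halfEquiv (· ∈ marked G)).symm.trans
    ((σ.toEquiv.subtypeEquiv fun j => by rw [RelIso.coe_fn_toEquiv, hσ j, not_not]).trans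
      (halfEquiv fun u => u ∉ marked G))
  map_rel_iff' := by
    intro a b
    simp only [Equiv.trans_apply, SimpleGraph.comap_adj, Function.Embedding.coe_subtype, halfEquiv_apply_coe,
      Equiv.subtypeEquiv_apply, RelIso.coe_fn_toEquiv]
    have ha := ((halfEquiv (· ∈ marked G)).symm a).2
    have hb := ((halfEquiv (· ∈ marked G)).symm b).2
    rw [← twinG_adj_iff (by rw [hσ, hσ, not_iff_not]; exact iff_of_true ha hb), σ.map_rel_iff,
      twinG_adj_iff (iff_of_true ha hb), fre_halfEquiv_symm, fre_halfEquiv_symm]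

end swap

/-! ### (⇒) From an isomorphism of the halves to a colour-swapping automorphism -/

section glue

variable {G : SimpleGraph (Fin m)}
  (φ : SimpleGraph.induce {u : Fin m | m ≤ (u : ℕ) + Nat.log 2 m ∧ u ∈ marked G} G ≃g
    SimpleGraph.induce {u : Fin m | m ≤ (u : ℕ) + Nat.log 2 m ∧ u ∉ marked G} G)

/-- **The glued map**: `φ` on the marked class, `φ⁻¹` on the unmarked class (in free indices). -/
noncomputable def swapFun (j : Fin (gg m)) : Fin (gg m) :=
  if h : fre m j ∈ marked G then ((halfEquiv fun u => u ∉ marked G).symm (φ (halfEquiv (· ∈ marked G) ⟨j, h⟩))).1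
  else ((halfEquiv (· ∈ marked G)).symm (φ.symm (halfEquiv (fun u => u ∉ marked G) ⟨j, h⟩))).1

/-- `swapFun` on the marked class. -/
theorem swapFun_pos {j : Fin (gg m)} (h : fre m j ∈ marked G) :
    swapFun φ j = ((halfEquiv fun u => u ∉ marked G).symm (φ (halfEquiv (· ∈ marked G) ⟨j, h⟩))).1 := dif_pos h

/-- `swapFun` on the unmarked class. -/
theorem swapFun_neg {j : Fin (gg m)} (h : fre m j ∉ marked G) :
    swapFun φ j = ((halfEquiv (· ∈ marked G)).symm (φ.symm (halfEquiv (fun u => u ∉ marked G) ⟨j, h⟩))).1 := dif_neg h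

/-- `swapFun` maps marked to unmarked. -/
theorem not_mk_swapFun {j : Fin (gg m)} (h : fre m j ∈ marked G) : fre m (swapFun φ j) ∉ marked G := by
  rw [swapFun_pos φ h]; exact ((halfEquiv fun u => u ∉ marked G).symm (φ (halfEquiv (· ∈ marked G) ⟨j, h⟩))).2

/-- `swapFun` maps unmarked to marked. -/
theorem mk_swapFun {j : Fin (gg m)} (h : fre m j ∉ marked G) : fre m (swapFun φ j) ∈ marked G := by
  rw [swapFun_neg φ h]; exact ((halfEquiv (· ∈ marked G)).symm (φ.symm (halfEquiv (fun u => u ∉ marked G) ⟨j, h⟩))).2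

/-- **`swapFun` swaps the marker classes.** -/
theorem mk_swapFun_iff (j : Fin (gg m)) : fre m (swapFun φ j) ∈ marked G ↔ fre m j ∉ marked G := by
  by_cases h : fre m j ∈ marked G
  · exact iff_of_false (not_mk_swapFun φ h) (not_not_intro h)
  · exact iff_of_true (mk_swapFun φ h) h

/-- The vertex of `swapFun` on the marked class is `φ`. -/
theorem fre_swapFun_pos {j : Fin (gg m)} (h : fre m j ∈ marked G) :
    fre m (swapFun φ j) = (φ (halfEquiv (· ∈ marked G) ⟨j, h⟩)).1 := by
  rw [swapFun_pos φ h, fre_halfEquiv_symm]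

/-- The vertex of `swapFun` on the unmarked class is `φ⁻¹`. -/
theorem fre_swapFun_neg {j : Fin (gg m)} (h : fre m j ∉ marked G) :
    fre m (swapFun φ j) = (φ.symm (halfEquiv (fun u => u ∉ marked G) ⟨j, h⟩)).1 := by
  rw [swapFun_neg φ h, fre_halfEquiv_symm]

/-- **`swapFun` is an involution.** -/
theorem swapFun_swapFun (j : Fin (gg m)) : swapFun φ (swapFun φ j) = j := by
  by_cases h : fre m j ∈ marked G
  · have hk := not_mk_swapFun φ h
    rw [swapFun_neg φ hk]
    have e : (⟨swapFun φ j, hk⟩ : {j : Fin (gg m) // fre m j ∉ marked G}) =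
        (halfEquiv fun u => u ∉ marked G).symm (φ (halfEquiv (· ∈ marked G) ⟨j, h⟩)) := Subtype.ext (swapFun_pos φ h)
    rw [e, Equiv.apply_symm_apply, RelIso.symm_apply_apply, Equiv.symm_apply_apply]
  · have hk := mk_swapFun φ h
    rw [swapFun_pos φ hk]
    have e : (⟨swapFun φ j, hk⟩ : {j : Fin (gg m) // fre m j ∈ marked G}) =
        (halfEquiv (· ∈ marked G)).symm (φ.symm (halfEquiv (fun u => u ∉ marked G) ⟨j, h⟩)) := Subtype.ext (swapFun_neg φ h)
    rw [e, Equiv.apply_symm_apply, RelIso.apply_symm_apply, Equiv.symm_apply_apply]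

/-- **`swapFun` preserves the twin graph.** -/
theorem twinG_adj_swapFun (a b : Fin (gg m)) : (twinG G).Adj (swapFun φ a) (swapFun φ b) ↔ (twinG G).Adj a b := by
  by_cases ha : fre m a ∈ marked G <;> by_cases hb : fre m b ∈ marked G
  · rw [twinG_adj_iff (iff_of_false (not_mk_swapFun φ ha) (not_mk_swapFun φ hb)), twinG_adj_iff (iff_of_true ha hb),
      fre_swapFun_pos φ ha, fre_swapFun_pos φ hb]
    exact φ.map_rel_iff
  · exact iff_of_false (not_twinG_adj (by rw [mk_swapFun_iff, mk_swapFun_iff]; tauto)) (not_twinG_adj (by tauto))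
  · exact iff_of_false (not_twinG_adj (by rw [mk_swapFun_iff, mk_swapFun_iff]; tauto)) (not_twinG_adj (by tauto))
  · rw [twinG_adj_iff (iff_of_true (mk_swapFun φ ha) (mk_swapFun φ hb)), twinG_adj_iff (iff_of_false ha hb),
      fre_swapFun_neg φ ha, fre_swapFun_neg φ hb]
    exact φ.symm.map_rel_iff

/-- **The glued automorphism** of the twin graph. -/
noncomputable def swapIso : twinG G ≃g twinG G where
  toEquiv := Function.Involutive.toPerm (swapFun φ) (swapFun_swapFun φ)
  map_rel_iff' := twinG_adj_swapFun φ _ _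

/-- Value of `swapIso`. -/
@[simp] theorem swapIso_apply (j : Fin (gg m)) : swapIso φ j = swapFun φ j := rfl

end glue

/-! ### The equivalence -/

/-- **Twin isomorphism is colour-swapping self-isomorphism of the twin graph**: the halves `G[A]`, `G[B]`
(`A`/`B` = free vertices adjacent / non-adjacent to vertex `0`) are isomorphic iff the coloured graphs
`(twinG G, chi true G)` and `(twinG G, chi false G)` are colour-isomorphic. -/
theorem twinIso_iff (G : SimpleGraph (Fin m)) :
    Nonempty
        (SimpleGraph.induce {u : Fin m | m ≤ (u : ℕ) + Nat.log 2 m ∧ ∃ h : 0 < m, G.Adj ⟨0, h⟩ u} G ≃g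
          SimpleGraph.induce {u : Fin m | m ≤ (u : ℕ) + Nat.log 2 m ∧ ¬ ∃ h : 0 < m, G.Adj ⟨0, h⟩ u} G) ↔
      ColIso (gg m) (twinG G) (chi true G) (twinG G) (chi false G) := by
  change Nonempty (SimpleGraph.induce {u : Fin m | m ≤ (u : ℕ) + Nat.log 2 m ∧ u ∈ marked G} G ≃g
    SimpleGraph.induce {u : Fin m | m ≤ (u : ℕ) + Nat.log 2 m ∧ u ∉ marked G} G) ↔
      ∃ σ : twinG G ≃g twinG G, ∀ v, chi false G (σ v) = chi true G v
  constructor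
  · rintro ⟨φ⟩
    exact ⟨swapIso φ, fun v => (chi_swap_iff G v _).2 (mk_swapFun_iff φ v)⟩
  · rintro ⟨σ, hσ⟩
    exact ⟨isoOfSwap σ fun j => (chi_swap_iff G j _).1 (hσ j)⟩

end Summit.PneNP.PneNP.Theorems.TwinIso

namespace Summit.PneNP.PneNP.Theorems

open Literature.Computability.Complexity TwinIso CompleteInvariant

/-- **Registered sub-goal of `stub_twinIsoInP_of_canonicalForm` (`stub_twinIsoInP_twinIso_iff`)**: twin
isomorphism of an `m`-vertex graph is colour-isomorphism of its two marker-coloured twin graphs (bridge file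
`SymmetryBudgetWindowBarrierTwinIsoBridge`). -/
theorem stub_twinIsoInP_twinIso_iff : ∀ (m : ℕ) (G : SimpleGraph (Fin m)), Nonempty (SimpleGraph.induce {u : Fin m | m ≤ (u : ℕ) + Nat.log 2 m ∧ ∃ h : 0 < m, G.Adj ⟨0, h⟩ u} G ≃g SimpleGraph.induce {u : Fin m | m ≤ (u : ℕ) + Nat.log 2 m ∧ ¬ ∃ h : 0 < m, G.Adj ⟨0, h⟩ u} G) ↔ ColIso (gg m) (twinG G) (chi true G) (twinG G) (chi false G) :=
  fun _ G => twinIso_iff G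

end Summit.PneNP.PneNP.Theorems
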